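import Summits.ResolutionOfSingularities.ResolutionOfSingularities.Theorems.HeightCutCells
import Mathlib.Data.Nat.Choose.Lucas
import Mathlib.Algebra.CharP.Lemmas
import HarnessLib

/-!
# CompanionAlgebra — decomp-res node «CompanionCut» (lens-4 g26, critic row 154), tree file 1/7 of the node

Content VERBATIM from the decomp-res lens-4 g26 node `HOME/decomp-res-lens-4/g26/CompanionCut.lean` (pin 12d9bf52, 1
262 l, 56 declarations;
HOME = run/shared/lean/pub/decomp-res) = ONE NEW PART §66–§70, NO CARRY, on top of the landed
`Theorems/HeightCutCells` (g25) +
`Theorems/MaxContactCutKangarooCut` (h71 wiring) + `Theorems/ContactFreeIsPPower` (lens-6).  Critic: CRITIC-LEDGER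
row 154 (CLEARED
2026-08-30T23:45:15Z, DECIDED +1 (ii*): THE COMPANION LAW at every weight — Hasse descent of a `p^e`-power form to
a weight-`p^e`
companion with LINEAR weak contact, Giraud transport with a typed jump dichotomy in every weight, the deciding implication
«eventually companion-jump-free ⇒ 31571's class» and the EXACT re-location of the g25 residual
`NoWildKangarooOffDoublePointTowers`
to the companion-recurrent towers `NoWildCompanionKangarooTowers`; inhabitants both sides).  Landing orders INBOX
:519 (lens-4 g26
landing note, split per NEXT-g27 §4) and :528 (critic): `--kind proof --supports
stmt-ResolutionOfSingularities-28338`, namespace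
`…Theorems.HugValuationCut`.  Landed by decomp-res writer g8 CONE-AWARE in seven files: `CompanionAlgebra` ·
`CompanionHasse` ·
`CompanionPresentation` (§66–§67) · `CompanionTransport` (§68) · `CompanionTowers` (§69) ·
`CompanionCutCells` (§70 cone-free cells and
hypothesis-free re-locations) are OUTSIDE the Theses cone (importable by the route file); the five §70 corollaries GIVEN 31571
`MaxContactCut.NoContactHuggingTowers` BY NAME are the in-cone wiring file `MaxContactCutCompanionCut`.  Aside
bookkeeping (row 154):
ONE successor aside on the lens-4 column, `NoWildCompanionKangarooTowers` (home `CompanionCutCells`) SUPERSEDING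
`HCNoWildKangarooOffDoublePointTowers` (g25, route rev 43); exactness `noWildKangarooOffDoublePointTowers_iff_companion (h71)`;
the decided cell `NoWildCompanionJumpFreeTowers` (⟸ 31571, `noWildCompanionJumpFreeTowers_of_item`) is not filed.

§66 (l. 101–228), first third: PURE COMMUTATIVE ALGEBRA in a local ring of characteristic `p` — Lucas at prime powers
(`natCast_choose_pow_mul`), `p^e`-th roots of residues (`exists_pow_pow_root_residue`), Frobenius linearity of the
`p^e`-power span
(`exists_pow_congr_of_mem_powSpan`), `not_mem_sq_of_pow_congr_exp`, degree bookkeeping, the homogeneous presentation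
`exists_isHomogeneous_eval_pow_of_mem_span`.  PROVED, 0 sorry.  Imports the landed `HeightCutCells` (+ Mathlib Lucas
/ CharP lemmas).  Cone-free.

[WRITER NOTE (decomp-res writer g8): section split only (400-line cap; §66 `section CompanionAlgebra` is re-opened
with the same
`variable` lines in `CompanionHasse` / `CompanionPresentation`); namespace, universes, section variables and every
declaration exactly
as in the lens (global `set_option` dropped; the lens's in-cone import `MaxContactCutKangarooCut` and the `open
…Theses` line live only
in the wiring file `MaxContactCutCompanionCut`).]

(Sources: Giraud1975 Thm 5.2; EncinasVillamayor2000 Thm 4.9; BravoGarciaEscamillaEncinasVillamayor2012 Lemma 4.6;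
KawanoueMatsuki2010; Kawanoue arXiv:math/0607009; CossartPiltant2008 §2; Cossart2011 ex. III.2; Hauser
arXiv:0811.4151; FruehbisKrueger arXiv:1007.2203 §3; BenitoVillamayor arXiv:1004.1803; Lucas 1878.)
-/

noncomputable section

open CategoryTheory AlgebraicGeometry IsLocalRing
open Literature.AlgebraicGeometry.Resolution
open Summit.ResolutionOfSingularities.ResolutionOfSingularities.Theorems
open WeakOrderReduction ForcedTowerClasses DivergentTowerClasses MonomialTowerClasses
open HugDimensionClasses HugDimensionKernels SurfaceShadowClasses SurfaceShadowKernels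
open NearPointCut (SingularClass)
open AbsoluteContactClasses (IsAbsContactAt SepResidueAt diffIdeal_restrict_le stalkMap_comp_toStalk_eq_stalkHom)
open scoped BigOperators

namespace Summit.ResolutionOfSingularities.ResolutionOfSingularities.Theorems.HugValuationCut

/-! ## §66 (g26 · NEW · KERNEL) HASSE DESCENT — the companion of a `p^e`-power form has linear weak contact of weight `p^e`

Pure commutative algebra in a local ring of characteristic `p`: Lucas at prime powers, `p^e`-th roots of residues, Frobenius
linearity of the `p^e`-power span, the homogeneous presentation `f ≡ Q(u^{p^e})`, and the main computation
`exists_hasse_apply_companion` (L0); then the Frobenius-maximal presentation of an ideal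
(`exists_companion_presentation`) and the
companion element with linear weak contact (`exists_companion_of_presentation`, L1 at ring level). -/

section CompanionAlgebra

variable {k R : Type*} [CommRing k] [CommRing R] [Algebra k R]

/-- **Lucas at a prime power, cast into characteristic `p`**: `C(p^e a, p^e b) = C(a, b)` in any ring of characteristic `p`
(Mathlib's `Choose.choose_mul_mul_modEq_choose_nat`, iterated). (Sources: folklore; Lucas 1878.) -/
theorem natCast_choose_pow_mul (p : ℕ) [Fact p.Prime] [CharP R p] (e a b : ℕ) :
    (((p ^ e * a).choose (p ^ e * b) : ℕ) : R) = ((a.choose b : ℕ) : R) := by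
  induction e with
  | zero => simp
  | succ e ih =>
    rw [pow_succ, mul_comm (p ^ e) p, mul_assoc, mul_assoc,
      (CharP.natCast_eq_natCast (R := R) (p := p)).mpr Choose.choose_mul_mul_modEq_choose_nat, ih]

/-- `p^e`-th roots of residue classes from `p`-th roots (`(b − c^p)^{p^e} = b^{p^e} − c^{p^{e+1}}`). [folklore] -/
theorem exists_pow_pow_root_residue [IsLocalRing R] (p : ℕ) [Fact p.Prime] [CharP R p]
    (hperf : ∀ a : R, ∃ b : R, a - b ^ p ∈ maximalIdeal R) (e : ℕ) (a : R) :
    ∃ b : R, a - b ^ (p ^ e) ∈ maximalIdeal R := by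
  induction e generalizing a with
  | zero => exact ⟨a, by simp⟩
  | succ e ih =>
    obtain ⟨b, hb⟩ := ih a
    obtain ⟨c, hc⟩ := hperf b
    refine ⟨c, ?_⟩
    have e1 : a - c ^ p ^ (e + 1) = (a - b ^ p ^ e) + (b - c ^ p) ^ p ^ e := by
      rw [sub_pow_char_pow_of_commute p e (Commute.all b (c ^ p)), ← pow_mul, ← pow_succ']; ring
    rw [e1]
    exact add_mem hb (Ideal.pow_le_self (pow_ne_zero e (Fact.out : p.Prime).ne_zero) (Ideal.pow_mem_pow hc _))

/-- **FROBENIUS LINEARITY OF THE `p^e`-POWER SPAN modulo `𝔪^{p^e+1}`** (g24 `exists_pow_congr_of_mem_pPowerSpan` at the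
exponent `p^e`): with `p^e`-th roots of residues, every element of `⟨h^{p^e} : h ∈ 𝔪⟩` is `≡ z^{p^e} (mod
𝔪^{p^e+1})`,
`z ∈ 𝔪`. (Sources: Hironaka1970Additive; Hauser2010Kangaroo; folklore.) -/
theorem exists_pow_congr_of_mem_powSpan [IsLocalRing R] (p : ℕ) [Fact p.Prime] [CharP R p] (e : ℕ)
    (hperf : ∀ a : R, ∃ b : R, a - b ^ (p ^ e) ∈ maximalIdeal R) {g : R}
    (hg : g ∈ Ideal.span ((fun h : R => h ^ (p ^ e)) '' ↑(maximalIdeal R))) :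
    ∃ z ∈ maximalIdeal R, g - z ^ (p ^ e) ∈ maximalIdeal R ^ (p ^ e + 1) := by
  have hw0 : p ^ e ≠ 0 := pow_ne_zero e (Fact.out : p.Prime).ne_zero
  induction hg using Submodule.span_induction with
  | mem x hx =>
    obtain ⟨h, hh, rfl⟩ := hx
    exact ⟨h, hh, by simp⟩
  | zero => exact ⟨0, zero_mem _, by simp [zero_pow hw0]⟩
  | add x y _ _ hx hy =>
    obtain ⟨z₁, hz₁, h₁⟩ := hx
    obtain ⟨z₂, hz₂, h₂⟩ := hy
    refine ⟨z₁ + z₂, add_mem hz₁ hz₂, ?_⟩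
    have e1 : x + y - (z₁ + z₂) ^ (p ^ e) = (x - z₁ ^ (p ^ e)) + (y - z₂ ^ (p ^ e)) := by
      rw [add_pow_char_pow_of_commute p e (Commute.all z₁ z₂)]; ring
    rw [e1]
    exact add_mem h₁ h₂
  | smul a x _ hx =>
    obtain ⟨z, hz, h⟩ := hx
    obtain ⟨b, hb⟩ := hperf a
    refine ⟨b * z, Ideal.mul_mem_left _ b hz, ?_⟩
    have e1 : a • x - (b * z) ^ (p ^ e) = a * (x - z ^ (p ^ e)) + (a - b ^ (p ^ e)) * z ^ (p ^ e) := by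
      rw [smul_eq_mul]; ring
    rw [e1]
    refine add_mem (Ideal.mul_mem_left _ a h) ?_
    rw [pow_succ']
    exact Ideal.mul_mem_mul hb (Ideal.pow_mem_pow hz _)

omit [Algebra k R] in
/-- the companion's weak-contact element is a REGULAR PARAMETER: `g ∉ M^{w+1}`, `g − c·z^w ∈ M^{w+1}`, `w ≥
1` ⟹ `z ∉ M²`.
[folklore] -/
theorem not_mem_sq_of_pow_congr_exp (M : Ideal R) {w : ℕ} (hw : 1 ≤ w) {g z c : R} (hg : g ∉ M ^ (w + 1))
    (h : g - c * z ^ w ∈ M ^ (w + 1)) : z ∉ M ^ 2 := by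
  intro hz
  have hzp : c * z ^ w ∈ M ^ (w + 1) := by
    refine Ideal.mul_mem_left _ c (Ideal.pow_le_pow_right (show w + 1 ≤ 2 * w by omega) ?_)
    rw [pow_mul]
    exact Ideal.pow_mem_pow hz w
  exact hg (by simpa using add_mem h hzp)

variable {ι : Type*} [Fintype ι]

omit [Algebra k R] [Fintype ι] in
/-- degree bookkeeping for truncated subtraction: `|α| ≤ |α − γ| + |γ|`. [folklore] -/
theorem degree_le_degree_tsub_add (α γ : ι →₀ ℕ) : α.degree ≤ (α - γ).degree + γ.degree := by
  have h1 : α ≤ α - γ + γ := le_tsub_add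
  have h2 : α + (α - γ + γ - α) = α - γ + γ := add_tsub_cancel_of_le h1
  have := congrArg Finsupp.degree h2
  rw [map_add, map_add] at this
  omega

omit [Algebra k R] [Fintype ι] in
/-- **THE FROBENIUS-TWISTED PRESENTATION (KERNEL, PROVED)**: in characteristic `p`, every element of `⟨h^{p^e} : h
∈ (u)^m⟩` is
`Q(u₁^{p^e}, …, u_r^{p^e})` for a form `Q` of degree `m` with coefficients in `R` (`h = H(u)` ⟹ `h^{p^e} =
(Frob^e H)(u^{p^e})`).
[folklore] -/
theorem exists_isHomogeneous_eval_pow_of_mem_span (p : ℕ) [Fact p.Prime] [CharP R p] (e m : ℕ) (u : ι → R) {g : R}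
    (hg : g ∈ Ideal.span ((fun h : R => h ^ (p ^ e)) '' ↑(Ideal.span (Set.range u) ^ m))) :
    ∃ Q : MvPolynomial ι R, Q.IsHomogeneous m ∧ MvPolynomial.eval (fun i => u i ^ (p ^ e)) Q = g := by
  haveI : ExpChar R p := ExpChar.prime (Fact.out : p.Prime)
  induction hg using Submodule.span_induction with
  | mem x hx =>
    obtain ⟨h, hh, rfl⟩ := hx
    obtain ⟨H, hH, rfl⟩ := (Ideal.mem_span_pow_iff_exists_isHomogeneous u h).mp hh
    refine ⟨MvPolynomial.map (iterateFrobenius R p e) H, hH.map _, ?_⟩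
    have e1 : (fun i => u i ^ (p ^ e)) = ⇑(iterateFrobenius R p e) ∘ u := by
      funext i; simp [iterateFrobenius_def]
    rw [MvPolynomial.eval_map, e1]
    show _ = (MvPolynomial.eval u H) ^ (p ^ e)
    rw [← iterateFrobenius_def p e, show MvPolynomial.eval u H = MvPolynomial.eval₂ (RingHom.id R) u H from rfl,
      MvPolynomial.eval₂_comp_left, RingHom.comp_id]
  | zero => exact ⟨0, MvPolynomial.isHomogeneous_zero _ _ _, by simp⟩
  | add x y _ _ hx hy =>
    obtain ⟨Q₁, hQ₁, h₁⟩ := hx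
    obtain ⟨Q₂, hQ₂, h₂⟩ := hy
    exact ⟨Q₁ + Q₂, hQ₁.add hQ₂, by rw [map_add, h₁, h₂]⟩
  | smul a x _ hx =>
    obtain ⟨Q, hQ, h⟩ := hx
    exact ⟨MvPolynomial.C a * Q, hQ.C_mul a, by rw [map_mul, MvPolynomial.eval_C, h, smul_eq_mul]⟩

end CompanionAlgebra

end Summit.ResolutionOfSingularities.ResolutionOfSingularities.Theorems.HugValuationCut
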